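import Summits.Ventures.PackingBounds.Energy.FivePointRieszSixDefs
import Summits.Ventures.PackingBounds.Energy.FivePointRieszSixMono
import Summits.Ventures.PackingBounds.Energy.FivePointRieszSixGramFacts
import Summits.Ventures.PackingBounds.Energy.FivePointRieszSixCongrFacts
import Summits.Ventures.PackingBounds.Energy.FivePointRieszSixSOSMerge1x0
import Summits.Ventures.PackingBounds.Energy.FivePointRieszSixSOSMerge1x1
import Summits.Ventures.PackingBounds.Energy.FivePointRieszSixSOSMerge1x2
import Summits.Ventures.PackingBounds.Energy.FivePointRieszSixSOSMerge1x3
import Summits.Ventures.PackingBounds.Energy.FivePointRieszSixSOSMerge1x4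
import Summits.Ventures.PackingBounds.Energy.FivePointRieszSixSOSMerge2x0
import Summits.Ventures.PackingBounds.Energy.FivePointRieszSixSOSMerge2x1
import Summits.Ventures.PackingBounds.Energy.FivePointRieszSixSOSPart0
import Summits.Ventures.PackingBounds.Energy.FivePointRieszSixSOSPart1
import Summits.Ventures.PackingBounds.Energy.FivePointRieszSixSOSPart10
import Summits.Ventures.PackingBounds.Energy.FivePointRieszSixSOSPart11
import Summits.Ventures.PackingBounds.Energy.FivePointRieszSixSOSPart12
import Summits.Ventures.PackingBounds.Energy.FivePointRieszSixSOSPart13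
import Summits.Ventures.PackingBounds.Energy.FivePointRieszSixSOSPart14
import Summits.Ventures.PackingBounds.Energy.FivePointRieszSixSOSPart2
import Summits.Ventures.PackingBounds.Energy.FivePointRieszSixSOSPart3
import Summits.Ventures.PackingBounds.Energy.FivePointRieszSixSOSPart4
import Summits.Ventures.PackingBounds.Energy.FivePointRieszSixSOSPart5
import Summits.Ventures.PackingBounds.Energy.FivePointRieszSixSOSPart6
import Summits.Ventures.PackingBounds.Energy.FivePointRieszSixSOSPart7
import Summits.Ventures.PackingBounds.Energy.FivePointRieszSixSOSPart8
import Summits.Ventures.PackingBounds.Energy.FivePointRieszSixSOSPart9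
import Summits.Ventures.PackingBounds.Energy.GramListQuadL
import HarnessLib

/-!
# `FivePointRieszSix`: the slack of the three-point inequality is `(1/K)·mᵀ X m` for the kernel-checked `X = P (S·Y) Pᵀ`, hence nonnegative

Framing: lottery ticket; floor = certified bounds/negative ranges. Venture `PackingBounds`, cell
`pub-packcert`, energy family E3PT (pub-packcert-energy gen 15; n = 3, d = 8 kernel route = KERNEL-D6 double data route, size-split).
`listQuad_partsR6`: `listQuad (mvecR6 u v t) xR6 0` = `quadL` over the explicit monomial list (`GramData.quadL_eq_listQuad`) = the sum of the
15 block polynomials of `FivePointRieszSixSOSPart*` (`GramData.quadL_append`; the blocks concatenate to `xR6` by `rfl`); `sum_parts_eqR6`: the merge tree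
`FivePointRieszSixSOSMerge*` collects them into 2 polynomial(s). `slack_bridgeR6`: `K · slack(u,v,t)` equals that sum (`ring` on collected polynomials).
`slack_nonnegR6`: by `GramData.listQuad_nonneg_of_congr` from the kernel-checked facts `RieszSixD8.congrR6_all` (congruence), `rowsR6_all` /
`ddR6_all` (PSD of S·Y).
-/

noncomputable section

namespace Summit.Ventures.PackingBounds.Energy.FivePointRieszSix

open Summit.Ventures.PackingBounds.Energy.GramData Summit.Ventures.PackingBounds.Energy.RieszSixD8

set_option maxRecDepth 100000 in
/-- The table `xR6` is the concatenation of the row blocks of the part files. -/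
theorem xR6_split : xR6 = xPart0R6 ++ (xPart1R6 ++ (xPart2R6 ++ (xPart3R6 ++ (xPart4R6 ++ (xPart5R6 ++ (xPart6R6 ++ (xPart7R6 ++ (xPart8R6 ++ (xPart9R6 ++ (xPart10R6 ++ (xPart11R6 ++ (xPart12R6 ++ (xPart13R6 ++ xPart14R6))))))))))))) := rfl

set_option maxRecDepth 100000 in
set_option maxHeartbeats 400000000 in
/-- `listQuad` over `xR6` with the monomial vector is the sum of the block polynomials. -/
theorem listQuad_partsR6 (u v t : ℝ) : listQuad (mvecR6 u v t) xR6 0 = SosPoly0KR6 u v t + SosPoly1KR6 u v t + SosPoly2KR6 u v t + SosPoly3KR6 u v t + SosPoly4KR6 u v t + SosPoly5KR6 u v t + SosPoly6KR6 u v t + SosPoly7KR6 u v t + SosPoly8KR6 u v t + SosPoly9KR6 u v t + SosPoly10KR6 u v t + SosPoly11KR6 u v t + SosPoly12KR6 u v t + SosPoly13KR6 u v t + SosPoly14KR6 u v t := by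
  have hL : (mlistR6 u v t).length = 165 := mlist_lengthR6 u v t
  have hrow : ∀ row ∈ xR6, row.length ≤ (mlistR6 u v t).length := by
    rw [hL]; exact (by decide +kernel : ∀ row ∈ xR6, row.length ≤ 165)
  have hlen : xR6.length + 0 ≤ (mlistR6 u v t).length := by rw [hL]; decide
  rw [← quadL_eq_listQuad (mvecR6 u v t) (mlistR6 u v t) (fun k _ => rfl) xR6 0 hrow hlen, mdrop0R6]
  rw [xR6_split, quadL_append, xPart0_lengthR6, mdrop1R6, quadL_append, xPart1_lengthR6, mdrop2R6, quadL_append, xPart2_lengthR6, mdrop3R6, quadL_append, xPart3_lengthR6, mdrop4R6, quadL_append, xPart4_lengthR6, mdrop5R6, quadL_append, xPart5_lengthR6, mdrop6R6, quadL_append, xPart6_lengthR6, mdrop7R6, quadL_append, xPart7_lengthR6, mdrop8R6, quadL_append, xPart8_lengthR6, mdrop9R6, quadL_append, xPart9_lengthR6, mdrop10R6, quadL_append, xPart10_lengthR6, mdrop11R6, quadL_append, xPart11_lengthR6, mdrop12R6, quadL_append, xPart12_lengthR6, mdrop13R6, quadL_append, xPart13_lengthR6, mdrop14R6, sospart0_eqR6,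 sospart1_eqR6, sospart2_eqR6, sospart3_eqR6, sospart4_eqR6, sospart5_eqR6, sospart6_eqR6, sospart7_eqR6, sospart8_eqR6, sospart9_eqR6, sospart10_eqR6, sospart11_eqR6, sospart12_eqR6, sospart13_eqR6, sospart14_eqR6]; ring

/-- The merge tree: the sum of the block polynomials equals `SosMrg2x0KR6 u v t + SosMrg2x1KR6 u v t`. -/
theorem sum_parts_eqR6 (u v t : ℝ) : SosPoly0KR6 u v t + SosPoly1KR6 u v t + SosPoly2KR6 u v t + SosPoly3KR6 u v t + SosPoly4KR6 u v t + SosPoly5KR6 u v t + SosPoly6KR6 u v t + SosPoly7KR6 u v t + SosPoly8KR6 u v t + SosPoly9KR6 u v t + SosPoly10KR6 u v t + SosPoly11KR6 u v t + SosPoly12KR6 u v t + SosPoly13KR6 u v t + SosPoly14KR6 u v t = SosMrg2x0KR6 u v t + SosMrg2x1KR6 u v t := by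
  linear_combination sosmrg1x0_eqR6 u v t + sosmrg1x1_eqR6 u v t + sosmrg1x2_eqR6 u v t + sosmrg1x3_eqR6 u v t + sosmrg1x4_eqR6 u v t + sosmrg2x0_eqR6 u v t + sosmrg2x1_eqR6 u v t

set_option maxRecDepth 100000 in
set_option maxHeartbeats 400000000 in
/-- `K · slack(u,v,t) = m(u,v,t)ᵀ X m(u,v,t)` with `K = scaleXR6` (block identities, merge tree, then `ring` on collected polynomials). -/
theorem slack_bridgeR6 (u v t : ℝ) :
    (scaleXR6 : ℝ) * ((pminKR6 u + pminKR6 v + pminKR6 t) / 3 - (c0KR6 + 3 * FexpKR6 u v t + FexpKR6 u u 1 + FexpKR6 v v 1 + FexpKR6 t t 1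
      + (a1KR6 * u + a1KR6 * v + a1KR6 * t) / 3))
      = listQuad (mvecR6 u v t) xR6 0 := by
  rw [listQuad_partsR6, sum_parts_eqR6]
  unfold pminKR6 FexpKR6 FexpK_c0R6 FexpK_c1R6 FexpK_c2R6 FexpK_c3R6 FexpK_c4R6 FexpK_c5R6 c0KR6 a1KR6 scaleXR6 SosMrg2x0KR6 SosMrg2x0K_c0R6 SosMrg2x0K_c1R6 SosMrg2x0K_c2R6 SosMrg2x0K_c3R6 SosMrg2x0K_c4R6 SosMrg2x0K_c5R6 SosMrg2x0K_c6R6 SosMrg2x0K_c7R6 SosMrg2x0K_c8R6 SosMrg2x0K_c9R6 SosMrg2x1KR6 SosMrg2x1K_c0R6 SosMrg2x1K_c1R6 SosMrg2x1K_c2R6 SosMrg2x1K_c3R6 SosMrg2x1K_c4R6 SosMrg2x1K_c5R6 SosMrg2x1K_c6R6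
  push_cast
  ring

set_option maxRecDepth 100000 in
set_option maxHeartbeats 0 in
/-- The slack polynomial of the three-point inequality (`N - 2 = 3`) is nonnegative everywhere: it is `(1/K)·mᵀ X m` with
`X = P (S·Y) Pᵀ` and `S·Y = L Lᵀ + E` (E diagonally dominant), all checked by kernel evaluation on integer data. -/
theorem slack_nonnegR6 (u v t : ℝ) :
    0 ≤ (pminKR6 u + pminKR6 v + pminKR6 t) / 3 - (c0KR6 + 3 * FexpKR6 u v t + FexpKR6 u u 1 + FexpKR6 v v 1 + FexpKR6 t t 1
      + (a1KR6 * u + a1KR6 * v + a1KR6 * t) / 3) := by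
  have hK : (0 : ℝ) < (scaleXR6 : ℝ) := by unfold scaleXR6; norm_num
  have hXlen : xR6.length = 165 := by decide
  have hXrow : ∀ m, m < 165 → (xR6.getD m []).length = 165 := by decide +kernel
  have hB : ∀ a, a < 165 → (bR6.getD a []).length = 158 := by decide +kernel
  have h := listQuad_nonneg_of_congr 165 158 158 bR6 yR6 xR6 lR6 eR6 hXlen hXrow hB congrR6_all rowsR6_all
    (of_checkDD ddR6_all) (mvecR6 u v t)
  rw [← slack_bridgeR6] at h
  exact (mul_nonneg_iff_of_pos_left hK).1 h

end Summit.Ventures.PackingBounds.Energy.FivePointRieszSix
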